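import Summits.ValiantsHypothesis.ValiantsHypothesis.Theorems.LacunarySymmetroidMatrixDescartesGraftLaw
import Summits.ValiantsHypothesis.ValiantsHypothesis.Theorems.LacunarySymmetroidMatrixDescartesGraftBorderAny

/-!
# `MatrixDescartes` census — THE BILINEAR LAW: the alternation table is monotone in BOTH directions, with gains

HONEST FRAMING.  Object-search cell `pub-symmetroid`, crux `Theses.LacunarySymmetroid.MatrixDescartes`
(stmt-ValiantsHypothesis-18050); seat val-sym-mdr-p1 (g3).  LOWER-bound bookkeeping in census (CONJECTURE-A) currency; nothing about the
crux `MatrixDescartes` (an upper bound at fat formats), `DoorA26` / `DoorA34`, or `VP ≠ VNP`.  No definitions.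

Composition of the seat's two laws — the BORDERING LAW (`Graft.exists_alternating_border_any_add`: one more row/column buys `#letters − 1`
alternations, any support) and the GRAFT LAW (`Graft.exists_alternating_add`: one more letter buys `size` alternations):
from ANY alternation certificate with `K+1` letters, size `m` and `N` alternations, for all `i, j` a certificate with `K+1+j` letters, size
`m+i` and `N + i·K + j·(m+i)` alternations (`exists_alternating_bilinear`; border first, then graft), and the row form
`not_posRootLawAt_bilinear : ¬ PosRootLawAt (m+i) (K+1+j) (N + i·K + j·(m+i) − 1)` (`N ≥ 1`).  [folklore]
-/

-- `Summit.ValiantsHypothesis.ValiantsHypothesis.…` repeats a component by the D-0017 layout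
-- (single-conjunct summit), which the `dupNamespace` linter flags; the name is mandated.
set_option linter.dupNamespace false

namespace Summit.ValiantsHypothesis.ValiantsHypothesis.Theorems.LacunarySymmetroidMatrixDescartes.Census.Graft

open Matrix Finset Filter Topology
open scoped BigOperators

/-- **THE BILINEAR LAW**: certificate `(m, K+1 letters, N)` ⇒ certificate `(m+i, K+1+j letters, N + i·K + j·(m+i))` for all `i, j`.
[folklore] -/
theorem exists_alternating_bilinear {m K N : ℕ} (d : Fin (K + 1) → ℕ)
    (S : Fin (K + 1) → Matrix (Fin m) (Fin m) ℝ) (hS : ∀ l, (S l).IsSymm)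
    (τ : Fin (N + 1) → ℝ) (hτ : StrictMono τ) (hpos : ∀ j, 0 < τ j)
    (hne : ∀ j, (∑ l, τ j ^ d l • S l).det ≠ 0)
    (halt : ∀ j : Fin N, (∑ l, τ j.castSucc ^ d l • S l).det * (∑ l, τ j.succ ^ d l • S l).det < 0) (i j : ℕ) :
    ∃ (d' : Fin (K + 1 + j) → ℕ) (S' : Fin (K + 1 + j) → Matrix (Fin (m + i)) (Fin (m + i)) ℝ)
      (τ' : Fin (N + i * K + j * (m + i) + 1) → ℝ),
      (∀ l, (S' l).IsSymm) ∧ StrictMono τ' ∧ (∀ j, 0 < τ' j) ∧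
      (∀ j, (∑ l, τ' j ^ d' l • S' l).det ≠ 0) ∧
      ∀ k : Fin (N + i * K + j * (m + i)),
        (∑ l, τ' k.castSucc ^ d' l • S' l).det * (∑ l, τ' k.succ ^ d' l • S' l).det < 0 := by
  obtain ⟨d₁, S₁, τ₁, -, hS₁, hτ₁, hpos₁, hne₁, halt₁⟩ := exists_alternating_border_any_add d S hS τ hτ hpos hne halt i
  exact exists_alternating_add ⟨d₁, S₁, τ₁, hS₁, hτ₁, hpos₁, hne₁, halt₁⟩ j

open Summit.ValiantsHypothesis.ValiantsHypothesis.Theorems.MatrixDescartes.Negative (PosRootLawAt)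

/-- **THE BILINEAR LAW, row form**: a certificate with `K+1` letters, size `m` and `N ≥ 1` alternations refutes
`PosRootLawAt (m+i) (K+1+j) (N + i·K + j·(m+i) − 1)` for all `i, j` — `ζ_sym(m+i, K+1+j) ≥ ζ_alt(m, K+1) + i·K + j·(m+i)`. [folklore] -/
theorem not_posRootLawAt_bilinear {m K N : ℕ} (hN : 1 ≤ N) (d : Fin (K + 1) → ℕ)
    (S : Fin (K + 1) → Matrix (Fin m) (Fin m) ℝ) (hS : ∀ l, (S l).IsSymm)
    (τ : Fin (N + 1) → ℝ) (hτ : StrictMono τ) (hpos : ∀ j, 0 < τ j)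
    (halt : ∀ j : Fin N, (∑ l, τ j.castSucc ^ d l • S l).det * (∑ l, τ j.succ ^ d l • S l).det < 0) (i j : ℕ) :
    ¬ PosRootLawAt (m + i) (K + 1 + j) (N + i * K + j * (m + i) - 1) := by
  have hne : ∀ j, (∑ l, τ j ^ d l • S l).det ≠ 0 :=
    ne_zero_of_alternating hN (fun j => (∑ l, τ j ^ d l • S l).det) halt
  obtain ⟨d', S', τ', hS', hτ', hpos', -, halt'⟩ := exists_alternating_bilinear d S hS τ hτ hpos hne halt i j
  exact not_posRootLawAt_of_alternating (by have := Nat.le_add_right N (i * K + j * (m + i)); omega)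
    d' S' hS' τ' hτ' hpos' halt'

/-- **Certificate ⇒ quadrant of rows (for the census generator)**: the hypotheses of `Census.not_posRootLawAt_of_certificate` with
`K+1` letters and `N ≥ 1` give, for all `i, j`, `¬ PosRootLawAt (m+i) (K+1+j) (N + i·K + j·(m+i) − 1)`. [folklore] -/
theorem not_posRootLawAt_bilinear_of_certificate {m K N : ℕ} {d : Fin (K + 1) → ℕ}
    {S : Fin (K + 1) → Matrix (Fin m) (Fin m) ℝ} {q : ℝ → ℝ}
    (hq : ∀ t : ℝ, (∑ l, t ^ d l • S l).det = q t) (hS : ∀ l, (S l).IsSymm)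
    (τ : Fin (N + 1) → ℝ) (hτ : StrictMono τ) (hpos : ∀ j, 0 < τ j)
    (halt : ∀ j : Fin N, q (τ j.castSucc) * q (τ j.succ) < 0) (hN : 1 ≤ N) (i j : ℕ) :
    ¬ PosRootLawAt (m + i) (K + 1 + j) (N + i * K + j * (m + i) - 1) :=
  not_posRootLawAt_bilinear hN d S hS τ hτ hpos (fun k => by rw [hq, hq]; exact halt k) i j

end Summit.ValiantsHypothesis.ValiantsHypothesis.Theorems.LacunarySymmetroidMatrixDescartes.Census.Graft
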